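import Summits.HodgeConjecture.HodgeConjecture.Theorems.CyclicUnitaryPowersLocalMonodromyReflection
import Literature.AlgebraicGeometry.HodgeTheory.CyclicCoverNodalMeridianLocalMonodromyBound
import HarnessLib

/-!
# Crux K1-A from the BOUND-FORM local monodromy (I): F1† ⇒ F1‡, the invariant line of the fibre, and the per-meridian
# recognition with `dim V ≤ p − 1` (route `CyclicUnitaryPowers`, item stmt-HodgeConjecture-19544)

Prover seat `hodge-nonav-prover-Ax` (g9), cell `hodge-nonav`. Landed `--supports stmt-HodgeConjecture-19544`; sorry-free,
no definition, no new named fact here. CONDITIONAL results; nothing here says HC ∕ HC_AV is proved; rung F-H1 is not moved.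

The fact F1† `carlsonToledo1999_nodalMeridianLocalMonodromy` asserts `dim V = p − 1` for the vanishing space `V` of a nodal
meridian; its discharge would need the INJECTIVITY of the vanishing homology of the `A_{p−1}` Milnor fibre in `H²` of the
nearby fibre (definiteness of the `A_{p−1}` form and its compatibility with the cup product — infrastructure the tree
lacks). The bound form F1‡ `carlsonToledo1999_nodalMeridianLocalMonodromyBound` (`dim V ≤ p − 1`; the bare localisation
principle `(T − 1)H² ⊆ im j`, `T ∘ j = j ∘ h_*`) suffices for K1 (sequel `CyclicUnitaryPowersPLPackageOfLocalMonodromyBound`,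
where the non-triviality of the meridian transports is recovered from `b₂`). Here:

* (F1† ⇒ F1‡ is proved in the Literature file next to the def);
* `finrank_eigenspace_deck_one_fibre` — `dim H²(𝒴_{[F]}; ℚ)^τ = 1` (CT1 transported along `e`);
* `exists_reflection_power_of_localMonodromyBound` — per meridian (`p` prime): from `T x − x ∈ V ≠ 0`,
  `Σ_{i<p} T^i|_V = 0`, `dim V ≤ p − 1`, a power `r = T^k ∈ Γ` is the cyclic reflection along `ℚ[τ]δ = range (T − 1)`,
  `T ∈ ⟨r⟩` (as `exists_reflection_power_of_localMonodromy`, the equality `dim V = p − 1` being unnecessary).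

## References

* [CarlsonToledo1999] J. A. Carlson, D. Toledo, Duke Math. J. 97 (1999), §2, §6 (kdoublept) and Proposition.
* [VoisinHodgeII2003] C. Voisin, Hodge Theory and Complex Algebraic Geometry II, §3.1.2, §6.2.1.
-/

noncomputable section

set_option linter.dupNamespace false

open CategoryTheory MvPolynomial _root_.Topology
open Literature.AlgebraicTopology.SingularHomology
open Literature.AlgebraicGeometry.Motives Literature.AlgebraicGeometry.Motives.UniversalHypersurface
open Literature.AlgebraicGeometry.HodgeTheory Literature.AlgebraicGeometry.HodgeTheory.UniversalHypersurface
open Literature.AlgebraicGeometry.FundamentalGroup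
open Summit.HodgeConjecture.HodgeConjecture.Theorems.SignSymmetricPowersMeridianMonodromy
open Summit.HodgeConjecture.HodgeConjecture.Theorems.CyclicUnitaryPowersPLPackageOfMeridians
open Summit.HodgeConjecture.HodgeConjecture.Theorems.CyclicUnitaryPowersNodalMeridianExists
open Summit.HodgeConjecture.HodgeConjecture.Theorems.CyclicUnitaryPowersMonodromyIsometry
open Summit.HodgeConjecture.HodgeConjecture.Theorems.CyclicUnitaryPowersDeckModelClauses
open Summit.HodgeConjecture.HodgeConjecture.Theorems.CyclicUnitaryPowersLocalMonodromyReflection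

namespace Summit.HodgeConjecture.HodgeConjecture.Theorems.CyclicUnitaryPowersLocalMonodromyBoundReflection

/-! ### §1 The invariant line of the fibre (F1† ⇒ F1‡ is `carlsonToledo1999_nodalMeridianLocalMonodromyBound_of_localMonodromy` in the Literature file) -/

section Fibre

variable {p : ℕ} [NeZero p] {f : MvPolynomial (Fin 3) ℂ}

/-- **`dim H²(𝒴_{[F]}; ℚ)^τ = 1`**: the invariant line of the model (`carlsonToledo1999_finrank_eigenspace_deck_one_holds`)
transported along `e` (which intertwines `τ` and `σ_F^*`). [cite: CarlsonToledo1999, §2 (held text p0005)] -/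
theorem finrank_eigenspace_deck_one_fibre (h3 : 3 ≤ p) (hf : f.IsHomogeneous p) (hf0 : f ≠ 0)
    (hX : IsSmoothProjective 2 (SmoothHypersurface.hypersurface (cyclicCoverForm p f)))
    (e : fiberOver (cyclicCoverFamily p) (cyclicCoverPoint p f) ≅ SmoothHypersurface.hypersurface (cyclicCoverForm p f))
    (τ : bettiCohomology (fiberOver (cyclicCoverFamily p) (cyclicCoverPoint p f)) 2 ≃ₗ[ℚ]
      bettiCohomology (fiberOver (cyclicCoverFamily p) (cyclicCoverPoint p f)) 2)
    (hτ : ∀ (ha : deckUnit p ∈ diagonalStabilizer (cyclicCoverForm p f))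
      (x : bettiCohomology (fiberOver (cyclicCoverFamily p) (cyclicCoverPoint p f)) 2),
      BettiUniverse.pullEquiv e 2 (τ x) =
        BettiUniverse.pull (diagonalAut (cyclicCoverForm p f) ha) 2 (BettiUniverse.pullEquiv e 2 x)) :
    Module.finrank ℚ ↥(Module.End.eigenspace
      (τ : bettiCohomology (fiberOver (cyclicCoverFamily p) (cyclicCoverPoint p f)) 2 →ₗ[ℚ]
        bettiCohomology (fiberOver (cyclicCoverFamily p) (cyclicCoverPoint p f)) 2) 1) = 1 := by
  have ha : deckUnit p ∈ diagonalStabilizer (cyclicCoverForm p f) := deckUnit_mem_diagonalStabilizer (NeZero.ne p) f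
  have hmap : (Module.End.eigenspace (τ : bettiCohomology (fiberOver (cyclicCoverFamily p) (cyclicCoverPoint p f)) 2 →ₗ[ℚ]
        bettiCohomology (fiberOver (cyclicCoverFamily p) (cyclicCoverPoint p f)) 2) 1).map
      (BettiUniverse.pullEquiv e 2 : bettiCohomology (fiberOver (cyclicCoverFamily p) (cyclicCoverPoint p f)) 2 →ₗ[ℚ]
        bettiCohomology (SmoothHypersurface.hypersurface (cyclicCoverForm p f)) 2) =
      Module.End.eigenspace (BettiUniverse.pull (diagonalAut (cyclicCoverForm p f) ha) 2) 1 := by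
    ext y
    simp only [Submodule.mem_map, Module.End.mem_eigenspace_iff, one_smul, LinearEquiv.coe_coe]
    constructor
    · rintro ⟨x, hx, rfl⟩
      rw [← hτ ha]
      exact congrArg _ hx
    · intro hy
      refine ⟨(BettiUniverse.pullEquiv e 2).symm y, ?_, LinearEquiv.apply_symm_apply _ y⟩
      apply (BettiUniverse.pullEquiv e 2).injective
      change BettiUniverse.pullEquiv e 2 (τ _) = _
      rw [hτ ha, LinearEquiv.apply_symm_apply, hy]
  rw [← LinearEquiv.finrank_map_eq (BettiUniverse.pullEquiv e 2), hmap]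
  exact carlsonToledo1999_finrank_eigenspace_deck_one_holds h3 f hf hf0 hX ha

end Fibre

/-! ### §2 Per meridian, bound form -/

section PerMeridian

variable {p : ℕ} [NeZero p] {f : MvPolynomial (Fin 3) ℂ}

/-- **From the BOUND-form local datum of a meridian transport to the cyclic reflection (a power of it).** For `p`
prime, `p ≥ 3`, a transport `T` of a loop at `[F]` with `T x − x ∈ V ≠ 0`, `Σ_{i<p} T^i|_V = 0`, `dim V ≤ p − 1`
(as `CyclicUnitaryPowersLocalMonodromyReflection.exists_reflection_power_of_localMonodromy`, equality not needed): `T ∈ Γ` preserves the cup form `B` (`transportedTraceForm_of_mem_ratMonodromyGroup`), commutes with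
`τ` (`ratTransport_comm_deck`), `τ^p = 1` (`pull_diagonalAut_pow_eq_one`), `dim V^τ = 1 < p − 1`
(`carlsonToledo1999_finrank_eigenspace_deck_one_holds`); so the recognition theorem
`exists_pow_isCyclicReflection_of_commute` gives `r = T^k ∈ Γ` with `T ∈ ⟨r⟩`, `IsCyclicReflection B τ δ r` along
`ℚ[τ]δ = V = range (T − 1)` with all §6 clauses. [cite: CarlsonToledo1999, §6 (kdoublept) and Proposition (held text p0013–p0014), §2 (p0005)] -/
theorem exists_reflection_power_of_localMonodromyBound (hp : p.Prime) (h3 : 3 ≤ p) (hf : f.IsHomogeneous p) (hf0 : f ≠ 0)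
    (hX : IsSmoothProjective 2 (SmoothHypersurface.hypersurface (cyclicCoverForm p f)))
    (e : fiberOver (cyclicCoverFamily p) (cyclicCoverPoint p f) ≅ SmoothHypersurface.hypersurface (cyclicCoverForm p f))
    (he : IsCompatibleFibreIso p e)
    (τ : bettiCohomology (fiberOver (cyclicCoverFamily p) (cyclicCoverPoint p f)) 2 ≃ₗ[ℚ]
      bettiCohomology (fiberOver (cyclicCoverFamily p) (cyclicCoverPoint p f)) 2)
    (hτ : ∀ (ha : deckUnit p ∈ diagonalStabilizer (cyclicCoverForm p f))
      (x : bettiCohomology (fiberOver (cyclicCoverFamily p) (cyclicCoverPoint p f)) 2),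
      BettiUniverse.pullEquiv e 2 (τ x) =
        BettiUniverse.pull (diagonalAut (cyclicCoverForm p f) ha) 2 (BettiUniverse.pullEquiv e 2 x))
    {γ : Path (cyclicCoverPoint p f) (cyclicCoverPoint p f)}
    {T : bettiCohomology (fiberOver (cyclicCoverFamily p) (cyclicCoverPoint p f)) 2 ≃ₗ[ℚ]
      bettiCohomology (fiberOver (cyclicCoverFamily p) (cyclicCoverPoint p f)) 2}
    (hT : IsRatTransport (cyclicCoverFamily p) 2 (cyclicCoverFamily_locallyTrivial p) (cyclicCoverLoopClass p γ) T)
    {W : Submodule ℚ (bettiCohomology (fiberOver (cyclicCoverFamily p) (cyclicCoverPoint p f)) 2)}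
    (hrange : ∀ x, T x - x ∈ W) (hsum : ∀ w ∈ W, ∑ i ∈ Finset.range p, (T ^ i) w = 0)
    (hdim : Module.finrank ℚ W ≤ p - 1) (hW0 : W ≠ ⊥) :
    ∃ (r : bettiCohomology (fiberOver (cyclicCoverFamily p) (cyclicCoverPoint p f)) 2 ≃ₗ[ℚ]
        bettiCohomology (fiberOver (cyclicCoverFamily p) (cyclicCoverPoint p f)) 2)
      (δ : bettiCohomology (fiberOver (cyclicCoverFamily p) (cyclicCoverPoint p f)) 2),
      r ∈ ratMonodromyGroup (cyclicCoverFamily p) 2 (cyclicCoverFamily_locallyTrivial p)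
        ⟨cyclicCoverPoint p f, Set.mem_univ _⟩ ∧
      T ∈ Subgroup.zpowers r ∧
      δ ≠ 0 ∧ (∑ i ∈ Finset.range p, (τ ^ i) δ) = 0 ∧
      Module.finrank ℚ (cyclicSpan τ δ) = p - 1 ∧
      (∀ x ∈ cyclicSpan τ δ, (∀ y ∈ cyclicSpan τ δ, transportedTraceForm hX e 2 x y = 0) → x = 0) ∧
      IsCyclicReflection (transportedTraceForm hX e 2) τ δ r ∧
      LinearMap.range ((T : _ →ₗ[ℚ] _) - LinearMap.id) = cyclicSpan τ δ := by
  have hp2 : 2 ≤ p := by omega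
  have hJ := CyclicCoverFormNonsingular.isNonsingularForm_cyclicCoverForm_of_isSmoothProjective hp2 hf hf0 hX
  haveI : Module.Finite ℚ (bettiCohomology (fiberOver (cyclicCoverFamily p) (cyclicCoverPoint p f)) 2) :=
    BettiUniverse.finite ((isSmoothProjectiveFamily_cyclicCoverFamily p).isSmoothProjective (cyclicCoverPoint p f)) 2
  have hBs : (transportedTraceForm hX e 2).IsSymm := transportedTraceForm_isSymm hX e (by decide)
  have hBnd : (transportedTraceForm hX e 2).Nondegenerate := transportedTraceForm_nondegenerate hX e
  -- `T ∈ Γ ⊆ O(B)`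
  have hTΓ : T ∈ ratMonodromyGroup (cyclicCoverFamily p) 2 (cyclicCoverFamily_locallyTrivial p)
      ⟨cyclicCoverPoint p f, Set.mem_univ _⟩ := mem_ratMonodromyGroup_of_isRatTransport _ _ _ hT
  have hTiso : ∀ x y, transportedTraceForm hX e 2 (T x) (T y) = transportedTraceForm hX e 2 x y :=
    transportedTraceForm_of_mem_ratMonodromyGroup hf hX hJ e hTΓ
  -- `T τ = τ T`
  have hcommeq : T * τ = τ * T := CyclicCoverScaling.ratTransport_comm_deck hp2 hf hf0 hX e he τ hτ γ hT
  have hcomm : ∀ x, T (τ x) = τ (T x) := fun x => LinearEquiv.congr_fun hcommeq x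
  -- `τ^p = 1`
  have ha : deckUnit p ∈ diagonalStabilizer (cyclicCoverForm p f) := deckUnit_mem_diagonalStabilizer (NeZero.ne p) f
  have hσp : BettiUniverse.pull (diagonalAut (cyclicCoverForm p f) ha) 2 ^ p = 1 :=
    pull_diagonalAut_pow_eq_one _ ha (deckUnit_pow_self hp.ne_zero) 2
  have hτi : ∀ (i : ℕ) (x : bettiCohomology (fiberOver (cyclicCoverFamily p) (cyclicCoverPoint p f)) 2),
      BettiUniverse.pullEquiv e 2 ((τ ^ i) x) =
        (BettiUniverse.pull (diagonalAut (cyclicCoverForm p f) ha) 2 ^ i) (BettiUniverse.pullEquiv e 2 x) := by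
    intro i
    induction i with
    | zero => intro x; rw [pow_zero, pow_zero, Module.End.one_apply]; rfl
    | succ i ih => intro x; rw [pow_succ, pow_succ, LinearEquiv.mul_apply, Module.End.mul_apply, ih, hτ ha]
  have hτp : τ ^ p = 1 := by
    refine LinearEquiv.ext fun x => (BettiUniverse.pullEquiv e 2).injective ?_
    rw [hτi, hσp, Module.End.one_apply]
    rfl
  -- `dim V^τ = 1 < p − 1`
  have hmap : (Module.End.eigenspace (τ : bettiCohomology (fiberOver (cyclicCoverFamily p) (cyclicCoverPoint p f)) 2 →ₗ[ℚ]
        bettiCohomology (fiberOver (cyclicCoverFamily p) (cyclicCoverPoint p f)) 2) 1).map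
      (BettiUniverse.pullEquiv e 2 : bettiCohomology (fiberOver (cyclicCoverFamily p) (cyclicCoverPoint p f)) 2 →ₗ[ℚ]
        bettiCohomology (SmoothHypersurface.hypersurface (cyclicCoverForm p f)) 2) =
      Module.End.eigenspace (BettiUniverse.pull (diagonalAut (cyclicCoverForm p f) ha) 2) 1 := by
    ext y
    simp only [Submodule.mem_map, Module.End.mem_eigenspace_iff, one_smul, LinearEquiv.coe_coe]
    constructor
    · rintro ⟨x, hx, rfl⟩
      rw [← hτ ha]
      exact congrArg _ hx
    · intro hy
      refine ⟨(BettiUniverse.pullEquiv e 2).symm y, ?_, LinearEquiv.apply_symm_apply _ y⟩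
      apply (BettiUniverse.pullEquiv e 2).injective
      change BettiUniverse.pullEquiv e 2 (τ _) = _
      rw [hτ ha, LinearEquiv.apply_symm_apply, hy]
  have hfix1 : Module.finrank ℚ ↥(Module.End.eigenspace
      (τ : bettiCohomology (fiberOver (cyclicCoverFamily p) (cyclicCoverPoint p f)) 2 →ₗ[ℚ]
        bettiCohomology (fiberOver (cyclicCoverFamily p) (cyclicCoverPoint p f)) 2) 1) = 1 := by
    rw [← LinearEquiv.finrank_map_eq (BettiUniverse.pullEquiv e 2), hmap]
    exact carlsonToledo1999_finrank_eigenspace_deck_one_holds h3 f hf hf0 hX ha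
  have hfix : Module.finrank ℚ ↥(Module.End.eigenspace
      (τ : bettiCohomology (fiberOver (cyclicCoverFamily p) (cyclicCoverPoint p f)) 2 →ₗ[ℚ]
        bettiCohomology (fiberOver (cyclicCoverFamily p) (cyclicCoverPoint p f)) 2) 1) < p - 1 := by
    rw [hfix1]; omega
  -- the recognition theorem
  obtain ⟨k, δ, h0, hΦ, hfr, hnd, hrefl, hzp, hCW, hRW⟩ :=
    exists_pow_isCyclicReflection_of_commute hp (transportedTraceForm hX e 2) hBnd hBs T τ hTiso hcomm hτp hfix W
      hrange hsum hdim hW0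
  exact ⟨T ^ k, δ, Subgroup.pow_mem _ hTΓ k, hzp, h0, hΦ, hfr, hnd, hrefl, by rw [hRW, hCW]⟩

end PerMeridian

end Summit.HodgeConjecture.HodgeConjecture.Theorems.CyclicUnitaryPowersLocalMonodromyBoundReflection

end
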